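import Mathlib
import Summits.NavierStokesRegularity.NavierStokesRegularity.Theorems.EulerZoomLiouvillePowerGaugeEulerLiouvilleWeakSupportDensityBootstrap
import Summits.NavierStokesRegularity.NavierStokesRegularity.Theorems.EulerZoomLiouvillePowerGaugeEulerLiouvilleMomentFloorGlue
import Summits.NavierStokesRegularity.NavierStokesRegularity.Theorems.EulerZoomLiouvillePowerGaugeEulerLiouvilleMomentFloorTools
import Literature.Analysis.FluidPDE.VorticityCalculus
import HarnessLib

/-!
# THE FLOOR AT EVERY ORDER: a ball floor at one order `q₁` is a ball floor at every `q₂ > q₁`, limit-free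
# (nsreg-p2 ROUND-53 «THE FLOOR» v1.2 §1 (P4) — ezl-w3's limit-free Hölder-up, referee R2 «land it as a SEPARATE theorem, `MomentFloorLaw` stays typed at q < 1»;
# seat ns-ezl-w3 g8, `--supports stmt-NavierStokesRegularity-19832 --as helper`)

* `MomentFloor.ballMoment_holderUp` — Hölder on a ball: `∫_{B_R}‖Ω‖^{q₁} ≤ ((4π/3)R³)^{1−q₁/q₂}(∫_{B_R}‖Ω‖^{q₂})^{q₁/q₂}` (the tool
  `integral_rpow_le_measureReal_support_rpow_mul` on `volume.restrict B_R`);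
* `MomentFloor.ballMomentFloor_mono_order` — `∫_{B_R}‖Ω‖^{q₁} ≥ ℓ₁R^{3−q₁(2+ρ)}` (`R ≥ R₁`) ⇒ `∫_{B_R}‖Ω‖^{q₂} ≥ ℓ₂R^{3−q₂(2+ρ)}` (`R ≥ max R₁ 1`), any real `ρ`,
  any `q₂ > q₁ > 0`, explicit `ℓ₂ = (ℓ₁(4π/3)^{−(1−q₁/q₂)})^{q₂/q₁}`;
* ★ `MomentFloor.momentFloor_allOrders_of_momentFloorLaw` — `MomentFloorLaw ρ V` (typed at `q < 1`, ezl-w2's `…MomentFloorGlue` BY NAME) gives the floor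
  `∫_{B_R}‖curl V‖^q ≥ ℓ·R^{3−q(2+ρ)}` for EVERY `q > 0`.

HONEST FRAMING: class-free real analysis about HYPOTHETICAL profiles (instrument-level); nothing about the crux E (`PowerGaugeEulerLiouville`, stmt 19832, OPEN)
or NS regularity is proved; not E. [nsreg-p2 R53 §1 (P4); folklore]
-/

noncomputable section

set_option linter.dupNamespace false

open MeasureTheory Set Filter Topology Metric Function TopologicalSpace
open scoped ENNReal NNReal RealInnerProductSpace Topology

namespace Summit.NavierStokesRegularity.NavierStokesRegularity.Theorems.PowerGaugeEulerLiouville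

open Literature.Analysis Literature.Analysis.FluidPDE

namespace MomentFloor

/-! ## R2 (referee): Hölder-up on sharp balls — a floor at one order is a floor at EVERY higher order, limit-free -/

/-- **Hölder-up on a ball**: for a continuous field `Ω`, `0 < q₁ < q₂` and `R > 0`,
`∫_{B_R}‖Ω‖^{q₁} ≤ (vol B_R)^{1 − q₁/q₂}·(∫_{B_R}‖Ω‖^{q₂})^{q₁/q₂}` with `vol B_R = (4π/3)R³` — the tool `integral_rpow_le_measureReal_support_rpow_mul`
on `volume.restrict B_R` (the support factor bounded by the whole ball). [folklore] -/
theorem ballMoment_holderUp {Ω : EuclideanSpace ℝ (Fin 3) → EuclideanSpace ℝ (Fin 3)} (hΩ : Continuous Ω)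
    {q₁ q₂ : ℝ} (hq₁ : 0 < q₁) (hq₁₂ : q₁ < q₂) {R : ℝ} (hR : 0 < R) :
    ∫ y in ball (0 : EuclideanSpace ℝ (Fin 3)) R, ‖Ω y‖ ^ q₁ ≤
      (R ^ 3 * (Real.pi * 4 / 3)) ^ (1 - q₁ / q₂) * (∫ y in ball (0 : EuclideanSpace ℝ (Fin 3)) R, ‖Ω y‖ ^ q₂) ^ (q₁ / q₂) := by
  have hq₂ : 0 < q₂ := hq₁.trans hq₁₂
  set μ : Measure (EuclideanSpace ℝ (Fin 3)) := volume.restrict (ball (0 : EuclideanSpace ℝ (Fin 3)) R) with hμ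
  haveI : IsFiniteMeasure μ := isFiniteMeasure_restrict.2 measure_ball_lt_top.ne
  have hint : Integrable (fun y => ‖Ω y‖ ^ q₂) μ :=
    ((hΩ.norm.rpow_const fun _ => Or.inr hq₂.le).continuousOn.integrableOn_compact
      (isCompact_closedBall (0 : EuclideanSpace ℝ (Fin 3)) R)).mono_set ball_subset_closedBall
  have h := integral_rpow_le_measureReal_support_rpow_mul (μ := μ) (fun y => norm_nonneg (Ω y)) hΩ.norm.measurable
    hq₁ hq₁₂ hint (measure_ne_top μ _)
  have hsupp : μ.real {x | ‖Ω x‖ ≠ 0} ≤ R ^ 3 * (Real.pi * 4 / 3) := by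
    calc μ.real {x | ‖Ω x‖ ≠ 0} ≤ μ.real univ := measureReal_mono (subset_univ _) (measure_ne_top μ _)
      _ = (volume (ball (0 : EuclideanSpace ℝ (Fin 3)) R)).toReal := by rw [hμ, measureReal_restrict_apply_univ, measureReal_def]
      _ = R ^ 3 * (Real.pi * 4 / 3) := WeakEulerian.volume_ball_toReal hR.le
  have hθ : 0 ≤ 1 - q₁ / q₂ := by have := (div_lt_one hq₂).2 hq₁₂; linarith
  exact h.trans (mul_le_mul_of_nonneg_right (Real.rpow_le_rpow measureReal_nonneg hsupp hθ)
    (Real.rpow_nonneg (integral_nonneg fun y => Real.rpow_nonneg (norm_nonneg _) _) _))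

/-- **A ball floor at order `q₁` is a ball floor at every order `q₂ > q₁`, limit-free** (ezl-w3's remark adopted in ROUND-53 §1 (P4), referee R2):
if `∫_{B_R}‖Ω‖^{q₁} ≥ ℓ₁·R^{3−q₁(2+ρ)}` for `R ≥ R₁` (`ℓ₁ > 0`), then `∫_{B_R}‖Ω‖^{q₂} ≥ ℓ₂·R^{3−q₂(2+ρ)}` for `R ≥ max R₁ 1`, with
`ℓ₂ = (ℓ₁·(4π/3)^{−(1−q₁/q₂)})^{q₂/q₁}` — ANY real `ρ`, any `q₂ > q₁ > 0` (also `q₂ ≥ 1`). [nsreg-p2 R53 §1 (P4); folklore] -/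
theorem ballMomentFloor_mono_order {Ω : EuclideanSpace ℝ (Fin 3) → EuclideanSpace ℝ (Fin 3)} (hΩ : Continuous Ω) {ρ q₁ q₂ ℓ₁ R₁ : ℝ}
    (hq₁ : 0 < q₁) (hq₁₂ : q₁ < q₂) (hℓ₁ : 0 < ℓ₁)
    (hfloor : ∀ R : ℝ, R₁ ≤ R → ℓ₁ * R ^ (3 - q₁ * (2 + ρ)) ≤ ∫ y in ball (0 : EuclideanSpace ℝ (Fin 3)) R, ‖Ω y‖ ^ q₁) :
    ∃ ℓ₂ : ℝ, 0 < ℓ₂ ∧ ∀ R : ℝ, max R₁ 1 ≤ R →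
      ℓ₂ * R ^ (3 - q₂ * (2 + ρ)) ≤ ∫ y in ball (0 : EuclideanSpace ℝ (Fin 3)) R, ‖Ω y‖ ^ q₂ := by
  have hq₂ : 0 < q₂ := hq₁.trans hq₁₂
  set v₁ : ℝ := Real.pi * 4 / 3 with hv₁def
  have hv₁ : 0 < v₁ := by rw [hv₁def]; positivity
  set θ : ℝ := q₁ / q₂ with hθdef
  have hθ : 0 < θ := div_pos hq₁ hq₂
  have hθ1 : θ < 1 := (div_lt_one hq₂).2 hq₁₂
  refine ⟨(ℓ₁ / v₁ ^ (1 - θ)) ^ θ⁻¹, Real.rpow_pos_of_pos (div_pos hℓ₁ (Real.rpow_pos_of_pos hv₁ _)) _, fun R hR => ?_⟩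
  have hR1 : 1 ≤ R := le_trans (le_max_right _ _) hR
  have hR0 : 0 < R := by linarith
  set J : ℝ := ∫ y in ball (0 : EuclideanSpace ℝ (Fin 3)) R, ‖Ω y‖ ^ q₂ with hJdef
  have hJ0 : 0 ≤ J := integral_nonneg fun y => Real.rpow_nonneg (norm_nonneg _) _
  -- `ℓ₁ R^{a₁} ≤ (v₁R³)^{1−θ} J^θ`, i.e. normalised: `ℓ₁ ≤ v₁^{1−θ} (R^{q₂(2+ρ)−3} J)^θ`
  have h1 : ℓ₁ * R ^ (3 - q₁ * (2 + ρ)) ≤ (R ^ 3 * v₁) ^ (1 - θ) * J ^ θ :=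
    (hfloor R (le_trans (le_max_left _ _) hR)).trans (ballMoment_holderUp hΩ hq₁ hq₁₂ hR0)
  set mJ : ℝ := R ^ (q₂ * (2 + ρ) - 3) * J with hmJdef
  have hmJ0 : 0 ≤ mJ := mul_nonneg (Real.rpow_nonneg hR0.le _) hJ0
  have hsplit : (R ^ 3 * v₁) ^ (1 - θ) * J ^ θ = R ^ (3 - q₁ * (2 + ρ)) * (v₁ ^ (1 - θ) * mJ ^ θ) := by
    rw [hmJdef, Real.mul_rpow (pow_nonneg hR0.le 3) hv₁.le, Real.mul_rpow (Real.rpow_nonneg hR0.le _) hJ0,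
      ← Real.rpow_natCast R 3, ← Real.rpow_mul hR0.le, ← Real.rpow_mul hR0.le]
    have hexp : R ^ (((3 : ℕ) : ℝ) * (1 - θ)) = R ^ (3 - q₁ * (2 + ρ)) * R ^ ((q₂ * (2 + ρ) - 3) * θ) := by
      rw [← Real.rpow_add hR0]
      congr 1
      have hqne : q₂ ≠ 0 := hq₂.ne'
      rw [hθdef]
      push_cast
      field_simp
      ring
    rw [hexp]; ring
  rw [hsplit] at h1
  have h2 : ℓ₁ ≤ v₁ ^ (1 - θ) * mJ ^ θ := le_of_mul_le_mul_left
    (by rw [mul_comm (R ^ (3 - q₁ * (2 + ρ))) ℓ₁]; exact h1) (Real.rpow_pos_of_pos hR0 _)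
  have hv : 0 < v₁ ^ (1 - θ) := Real.rpow_pos_of_pos hv₁ _
  have h3 : ℓ₁ / v₁ ^ (1 - θ) ≤ mJ ^ θ := by rw [div_le_iff₀ hv]; linarith
  have h4 := Real.rpow_le_rpow (div_nonneg hℓ₁.le hv.le) h3 (inv_pos.2 hθ).le
  rw [Real.rpow_rpow_inv hmJ0 hθ.ne'] at h4
  -- un-normalise
  have e : J = R ^ (3 - q₂ * (2 + ρ)) * mJ := by
    rw [hmJdef, ← mul_assoc, ← Real.rpow_add hR0, show 3 - q₂ * (2 + ρ) + (q₂ * (2 + ρ) - 3) = 0 by ring,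
      Real.rpow_zero, one_mul]
  rw [e, mul_comm]
  exact mul_le_mul_of_nonneg_left h4 (Real.rpow_nonneg hR0.le _)

/-- ★ **THE FLOOR AT EVERY ORDER** (referee R2; `MomentFloorLaw` stays typed at `q < 1`, this is the separate limit-free extension): for a budget-class
profile with `curl V ≢ 0`, `MomentFloorLaw ρ V` gives `∫_{B_R}‖curl V‖^q ≥ ℓ·R^{3−q(2+ρ)}` for all large `R` for EVERY `q > 0` (for `q ≥ 1` from the
floor at `q₁ = ½` by `ballMomentFloor_mono_order`). [nsreg-p2 R53 §1 (P4)] -/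
theorem momentFloor_allOrders_of_momentFloorLaw {ρ : ℝ} {V : EuclideanSpace ℝ (Fin 3) → EuclideanSpace ℝ (Fin 3)}
    (hfloor : MomentFloorLaw ρ V) :
    ∀ P : EuclideanSpace ℝ (Fin 3) → ℝ, IsSelfSimilarEulerProfile (1 / (2 + ρ)) 0 V P →
      (∫⁻ y, ‖fderiv ℝ V y‖ₑ ^ 2 * ENNReal.ofReal (‖y‖ ^ (ρ - 1))) ≠ ⊤ →
      (∃ A : ℝ, ∀ R : ℝ, 1 ≤ R → ∫ y in Metric.ball (0 : EuclideanSpace ℝ (Fin 3)) R, ‖V y‖ ^ 2 ≤ A * R ^ (1 - 2 * ρ)) →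
      (∃ y, curl V y ≠ 0) →
        ∀ q : ℝ, 0 < q → ∃ ℓ R₁ : ℝ, 0 < ℓ ∧ ∀ R : ℝ, R₁ ≤ R →
          ℓ * R ^ (3 - q * (2 + ρ)) ≤ ∫ y in Metric.ball (0 : EuclideanSpace ℝ (Fin 3)) R, ‖curl V y‖ ^ q := by
  intro P hprof hE hA hne q hq
  by_cases hq1 : q < 1
  · exact hfloor P hprof hE hA hne q hq hq1
  · have hΩc : Continuous (curl V) := (contDiff_curl (n := 1) (by exact_mod_cast hprof.contDiff_velocity)).continuous
    obtain ⟨ℓ₁, R₁, hℓ₁, hfl⟩ := hfloor P hprof hE hA hne (1 / 2) (by norm_num) (by norm_num)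
    have hq12 : (1 / 2 : ℝ) < q := by push Not at hq1; linarith
    obtain ⟨ℓ₂, hℓ₂, hfl₂⟩ := ballMomentFloor_mono_order hΩc (by norm_num) hq12 hℓ₁ hfl
    exact ⟨ℓ₂, max R₁ 1, hℓ₂, hfl₂⟩

end MomentFloor

end Summit.NavierStokesRegularity.NavierStokesRegularity.Theorems.PowerGaugeEulerLiouville

end
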